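import Summits.AtomisticToContinuum.BoseEinsteinCondensation.Theses.BECInsertionCorrector
import Summits.AtomisticToContinuum.BoseEinsteinCondensation.Theorems.CorrectorClosure.Negative.InsertionResidueLoadBearing
import Literature.MathematicalPhysics.QuantumManyBody.WeightedCorrector

/-!
# Line `geometric-mean-corrector` — skeleton for the crux `BECInsertionCorrector.CorrectorClosure`
(crux item stmt-AtomisticToContinuum-12058, rank 3, route `route-AtomisticToContinuum-BECInsertionCorrector`)

Crux (FIXED, by name): `CorrectorClosure := StaticResponseBound → InsertionResidue` — given the static
response bound K1, the zero-momentum insertion overlap ("quasi-particle residue")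
`Z_N = L⁻³ |∫ conj Θ(X) ∫_cell Ψ(x,X) dx dX|²` of SOME δ-near-minimiser `Θ` of the periodic `N`-body energy with
EVERY δ-near-minimiser `Ψ` of the periodic `(N+1)`-body energy (torus of side `L = ((N+1)/ρ)^{1/3}`, `ρ < ρ₀(v)`,
`N` large, `δ = δ_N` chosen after `N`) is bounded below.

Idea (card `Ideas/geometric-mean-corrector.md`, triage r1-1/2/3: pass): do not expand `ψ = −log h`,
`h = |Φ|/|Θ∘tail|` (`Θ`, `Φ` the positive torus ground states), around the undressed law; use the exact
Chernoff/Hölder path of tilts `π_s ∝ h^{2s}·|Θ∘tail|² dZ` and its MIDPOINT, the geometric-mean ("mixed estimator")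
law `m = π_{1/2} ∝ |Θ∘tail|·|Φ| dZ`, under which `ψ` is ONE linear weak corrector of the impurity energy
`W − μ_N`. Planner's closed form of the card's identity `log(1/Z) = 4∫₀¹ min(s,1−s) Var_{π_s}ψ ds`:

  `Z_N = 1 / (E_m e^{u} · E_m e^{−u})`,  `u = ψ − E_m ψ`     (Bhattacharyya–Kantorovich identity),

with `log E_m e^{u} = H(m‖π₀) = 4∫₀^{1/2} s·Var_{π_s}ψ ds` (INSERTION half: mixed law vs bath ⊗ uniform impurity)
and `log E_m e^{−u} = H(m‖π₁) = 4∫_{1/2}^{1} (1−s)·Var_{π_s}ψ ds` (REMOVAL half: mixed law vs full ground state).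
So the crux for exact ground states is EXACTLY: two one-sided unit exponential moments of the centred midpoint
corrector under the midpoint law (no `sup_s`, no exponential moments at large parameter, hard-core `P`-factor
absorbed: `E_{π₀}[h] = E_{π₀}[h; h > 0]`).

THE LINE (7 registered stubs, all glued by `CorrectorClosure_of`; ground states of admissible `v` need not be `C¹`
(hard cores, cusps), so the analysis runs on the bounded truncations `v_n = min(v,n)` and is transferred by fixed-`N`
stability):
* `stub_truncationStableResponse` (S0) — K1 BY NAME ⇒ the K1-clause holds for the truncation family `v_n`, `n ≥ n₀`,
  with ONE pair of constants `(ρ_K, C_K)`. Trivial for bounded `v` (`v_n = v`); for hard-core/cusp `v` it is the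
  truncation-uniform form of K1 (debt of stmt-12057's technology, flagged to the route planner).
* `stub_truncationRemoval` (S1) — a residue bound for `δ`-near-minimisers of `v_n`, uniform in `n ≥ n₀` (δ after N,
  before n), implies the `InsertionResidue` clause for `v` (monotone form convergence `E₀(v_n,M,L) ↑ E₀(v,M,L) < ⊤`
  at fixed `M ∈ {N,N+1}`, `L`, low density; Hedberg synthesis for pathological `⊤`-sets).
* `stub_groundStateRigidity` (S2) — fixed-`N` Perron–Frobenius package, truncation-stable: at low density and large
  `N`, for `n ≥ n₀` the `v_n` torus ground states `Θ₀ⁿ, Φ₀ⁿ` are positive `C¹` periodic states of finite energy, and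
  every pair of `δ`-near-minimisers `(Θ, Ψ)` has residue `≥ residue(Θ₀ⁿ,Φ₀ⁿ) − ε` (gap + Cauchy–Schwarz; the window
  of Disproof §3/§7).
* `stub_mixedLawResidue` (S3) — the identity above as an inequality: `E_m e^{u} ≤ e^U`, `E_m e^{−u} ≤ e^D` ⇒
  `e^{−U−D} ≤ residue(Θ,Φ)` (Fubini on `cell × cell^N`, `withDensity`/`tilted` algebra).
* `stub_tiltCorrector` (S4) — the card's lever, `C¹` version for BOUNDED `w` (triage r1-2): for positive `C¹` ground
  states and every `s : ℝ`, `ψ` is a weak corrector of `(W − μ_N) + (2s−1)|∇ψ|²` for the weight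
  `F_s = |Θ∘tail|^{1−s}|Φ|^s` (`s = ½`: LINEAR, geometric-mean weight; `s = 0, 1`: the two Riccati ends).
* `stub_insertionHalf` (S5) — uniform bound `E_m e^{u} ≤ e^{C}` for ground states of the truncation family from its
  K1-clause (undressed side: product law + recoil at `s = 0`; UV-singular in the hard-core limit).
* `stub_removalHalf` (S6, HARDEST) — uniform bound `E_m e^{−u} ≤ e^{C}` (dressed side: Fisher budget
  `E_{π₁}|∇ψ|² ≤ μ_N`, no product structure, no recoil lemma — the infrared heart).
* `CorrectorClosure_of : CorrectorClosure` — the kernel-checked composition (no `sorry` of its own).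

Disproof.lean (gen 2) honoured: §1 (`not_correctorClosure_iff`: K1 must be consumed) — K1 enters BY NAME through S0
and is the hypothesis of S5/S6 via the K1-clause of each `v_n`; §3/§7 (`insertionResidue_false_without_window`,
`insertionResidue_false_uniformWindow`) — the near-minimiser window `δ = δ(N, ε)` is produced by S2 AFTER `N` and
consumed by S1; no stub drops it or makes it `N`-uniform; §4 (`insertionResidue_false_without_finiteRange`) —
finiteness `E₀^{per}(v, N+1, L_N) < ⊤` at low density is used inside S1/S2 (finite range of `v`), and S4–S6 carry
`periodicEnergy ≠ ⊤` hypotheses; §5 (tightness `residue ≤ 1`) is consistent with S3 (`U, D ≥ 0` by Jensen).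
No stub is an instance of a landed `Theorems/CorrectorClosure/Negative/*` lemma (imported below and checked: those
refute the window-less / finite-range-less / N-uniform-window variants only).
-/

noncomputable section

namespace Summit.AtomisticToContinuum.BoseEinsteinCondensation.Cruxes.CorrectorClosure.GeometricMeanCorrector

open MeasureTheory Filter
open scoped ENNReal NNReal ComplexConjugate BigOperators
open Literature.MathematicalPhysics.QuantumManyBody.BoseGas
open Summit.AtomisticToContinuum.BoseEinsteinCondensation.Theses.BECInsertionCorrector

set_option linter.unusedVariables false

/-! ## S0 — static response is stable under truncation of the core (K1 by name) -/

/-- **S0 `stub_truncationStableResponse`.** `StaticResponseBound` (crux 12057, BY NAME) implies that the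
truncation family `v_n = min(v, n)` of an admissible `v` satisfies the K1-clause with ONE pair of constants
`(ρ_K, C_K)` for all `n ≥ n₀`. Why plausibly true: for bounded `v` take `n₀ ≥ sup v` (`v_n = v`) and K1's own
constants — immediate; for unbounded `v` (hard core, cusps) K1's constants depend on `v` only through the
scattering length `a(v_n) ↑ a(v) ≤ R₀` and the range `R₀` in every known proof technology (LHY-precision energy
bounds, localisation), so the clause is uniform in the truncation height; as TYPED, K1 quantifies `∃ ρ₀ C` after
`v`, so this uniformity is genuinely asserted here (route-level remark: restating K1 with constants depending on
`(a, R₀)` only would make S0 a one-liner). Size: S (bounded `v`) / L (= uniform K1 otherwise). -/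
theorem stub_truncationStableResponse :
    StaticResponseBound →
    ∀ (v : ℝ → ℝ≥0∞), IsRepulsiveFiniteRange v →
      ∃ ρK : ℝ, 0 < ρK ∧ ∃ CK : ℝ, 0 < CK ∧ ∃ n₀ : ℕ, ∀ n : ℕ, n₀ ≤ n →
        ∀ ρ : ℝ, 0 < ρ → ρ < ρK → ∀ N : ℕ, ∀ k : Fin 3 → ℤ, k ≠ 0 → ∀ t : ℝ,
          ∀ Ψ : PeriodicTrialState N (sideLength ρ N),
            periodicEnergy (fun r => min (v r) (n : ℝ≥0∞)) Ψ ≠ ⊤ →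
            (periodicGroundStateEnergy (fun r => min (v r) (n : ℝ≥0∞)) N (sideLength ρ N)).toReal
                - CK * t ^ 2 * N / max (ρ * (scatteringLength (fun r => min (v r) (n : ℝ≥0∞))).toReal)
                    ((2 * Real.pi / sideLength ρ N) ^ 2 * ∑ i, (k i : ℝ) ^ 2)
              ≤ (periodicEnergy (fun r => min (v r) (n : ℝ≥0∞)) Ψ).toReal
                + t * ∫ X in cellN N (sideLength ρ N),
                    (∑ j, Real.cos (2 * Real.pi / sideLength ρ N * ∑ i, (k i : ℝ) * X j i)) * ‖Ψ.ψ X‖ ^ 2 := by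
  sorry

/-! ## S1 — removal of the truncation (fixed-`N` monotone form convergence) -/

/-- **S1 `stub_truncationRemoval`.** If the residue bound holds for ALL `δ`-near-minimisers `Θ` (N bodies) and
`Ψ` (N+1 bodies) of the truncated potentials `v_n`, with `(ρ₀, c)` and, at each large `N`, a window `δ > 0`
uniform in `n ≥ n₀`, then the `InsertionResidue` clause holds for `v` itself. Why true: at fixed `M ∈ {N, N+1}`
and `L = L_N`, `periodicEnergy v_n ≤ periodicEnergy v` and `E₀(v_n, M, L) ↑ E₀(v, M, L)` as `n → ∞` whenever the
limit is finite (monotone convergence of the closed forms + Rellich compactness on the torus + density of the `C¹`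
periodic symmetric core in the hard-core form domain — `H¹₀` of the free region; Hedberg's synthesis theorem for a
general closed `⊤`-set), and `E₀(v, N+1, L_N) < ⊤` for `ρ < ρ₀(v)`, `N` large (finite range: separated bumps); so
a `δ/2`-near-minimiser `Θ` of `v` exists and is a `δ`-near-minimiser of `v_n`, and every `δ/2`-near-minimiser `Ψ`
of `v` is one of `v_n`, for `n ≥ n₀` large. Size: M–L (no spectral theory of torus Schrödinger forms in tree). -/
theorem stub_truncationRemoval :
    ∀ (v : ℝ → ℝ≥0∞), IsRepulsiveFiniteRange v →
      (∃ ρ₀ : ℝ, 0 < ρ₀ ∧ ∀ ρ : ℝ, 0 < ρ → ρ < ρ₀ → ∃ c : ℝ, 0 < c ∧ ∀ᶠ N : ℕ in atTop,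
        ∃ δ : ℝ≥0∞, 0 < δ ∧ ∃ n₀ : ℕ, ∀ n : ℕ, n₀ ≤ n →
          ∀ Θ : PeriodicTrialState N (sideLength ρ (N + 1)),
            periodicEnergy (fun r => min (v r) (n : ℝ≥0∞)) Θ ≤
              periodicGroundStateEnergy (fun r => min (v r) (n : ℝ≥0∞)) N (sideLength ρ (N + 1)) + δ →
          ∀ Ψ : PeriodicTrialState (N + 1) (sideLength ρ (N + 1)),
            periodicEnergy (fun r => min (v r) (n : ℝ≥0∞)) Ψ ≤
              periodicGroundStateEnergy (fun r => min (v r) (n : ℝ≥0∞)) (N + 1) (sideLength ρ (N + 1)) + δ →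
            ENNReal.ofReal c ≤ ENNReal.ofReal ((sideLength ρ (N + 1) ^ 3)⁻¹) *
              (‖∫ X in cellN N (sideLength ρ (N + 1)), conj (Θ.ψ X) *
                  ∫ x in cell (sideLength ρ (N + 1)), Ψ.ψ (Matrix.vecCons x X)‖₊ : ℝ≥0∞) ^ 2) →
      ∃ ρ₀ : ℝ, 0 < ρ₀ ∧ ∀ ρ : ℝ, 0 < ρ → ρ < ρ₀ → ∃ c : ℝ, 0 < c ∧ ∀ᶠ N : ℕ in Filter.atTop,
        ∃ δ : ENNReal, 0 < δ ∧ ∃ Θ : PeriodicTrialState N (sideLength ρ (N + 1)),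
          periodicEnergy v Θ ≤ periodicGroundStateEnergy v N (sideLength ρ (N + 1)) + δ ∧
          ∀ Ψ : PeriodicTrialState (N + 1) (sideLength ρ (N + 1)),
            periodicEnergy v Ψ ≤ periodicGroundStateEnergy v (N + 1) (sideLength ρ (N + 1)) + δ →
            ENNReal.ofReal c ≤ ENNReal.ofReal ((sideLength ρ (N + 1) ^ 3)⁻¹) *
              (‖∫ X in cellN N (sideLength ρ (N + 1)), conj (Θ.ψ X) *
                  ∫ x in cell (sideLength ρ (N + 1)), Ψ.ψ (Matrix.vecCons x X)‖₊ : ENNReal) ^ 2 := by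
  sorry

/-! ## S2 — fixed-`N` rigidity of the torus ground states, stable under truncation -/

/-- **S2 `stub_groundStateRigidity`.** At low density and for all large `N`: for every `ε > 0` there are a window
`δ > 0` and `n₀` such that for every truncation height `n ≥ n₀` the periodic `N`- and `(N+1)`-body problems for
`v_n = min(v,n)` on the torus of side `L_N = ((N+1)/ρ)^{1/3}` have POSITIVE `C¹` ground states `Θ₀, Φ₀` (real,
`> 0` everywhere, attaining `E₀`, finite energy), and every pair `(Θ, Ψ)` of `δ`-near-minimisers has residue at
least `residue(Θ₀, Φ₀) − ε`. Why plausibly true: `v_n` is bounded, so the torus ground states are `W^{2,p}`,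
hence `C^{1,α}`, strictly positive (Harnack) and simple (Perron–Frobenius); the spectral gap at fixed `(N, L)` gives
`‖Ψ − αΦ₀‖² ≤ 2δ/gap`, and the overlap functional is `1`-Lipschitz in each argument (Cauchy–Schwarz, Disproof §5 /
Negative `overlap_sq_le_one`-type bounds); uniformity of `δ` in `n ≥ n₀` is joint compactness as `n → ∞` plus
simplicity of the hard-core ground state (connectivity of the free configuration space at low density — the one
geometric input; trivial for bounded `v`, where `v_n = v`). The window depends on `N` (Disproof §7). Size: L. -/
theorem stub_groundStateRigidity :
    ∀ (v : ℝ → ℝ≥0∞), IsRepulsiveFiniteRange v →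
      ∃ ρ₁ : ℝ, 0 < ρ₁ ∧ ∀ ρ : ℝ, 0 < ρ → ρ < ρ₁ → ∀ᶠ N : ℕ in atTop, ∀ ε : ℝ, 0 < ε →
        ∃ δ : ℝ≥0∞, 0 < δ ∧ ∃ n₀ : ℕ, ∀ n : ℕ, n₀ ≤ n →
          ∃ (Θ₀ : PeriodicTrialState N (sideLength ρ (N + 1)))
            (Φ₀ : PeriodicTrialState (N + 1) (sideLength ρ (N + 1))),
            (∀ X, Θ₀.ψ X = (‖Θ₀.ψ X‖ : ℂ) ∧ 0 < ‖Θ₀.ψ X‖) ∧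
            (∀ Z, Φ₀.ψ Z = (‖Φ₀.ψ Z‖ : ℂ) ∧ 0 < ‖Φ₀.ψ Z‖) ∧
            periodicEnergy (fun r => min (v r) (n : ℝ≥0∞)) Θ₀ =
              periodicGroundStateEnergy (fun r => min (v r) (n : ℝ≥0∞)) N (sideLength ρ (N + 1)) ∧
            periodicEnergy (fun r => min (v r) (n : ℝ≥0∞)) Φ₀ =
              periodicGroundStateEnergy (fun r => min (v r) (n : ℝ≥0∞)) (N + 1) (sideLength ρ (N + 1)) ∧
            periodicEnergy (fun r => min (v r) (n : ℝ≥0∞)) Θ₀ ≠ ⊤ ∧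
            periodicEnergy (fun r => min (v r) (n : ℝ≥0∞)) Φ₀ ≠ ⊤ ∧
            ∀ Θ : PeriodicTrialState N (sideLength ρ (N + 1)),
              periodicEnergy (fun r => min (v r) (n : ℝ≥0∞)) Θ ≤
                periodicGroundStateEnergy (fun r => min (v r) (n : ℝ≥0∞)) N (sideLength ρ (N + 1)) + δ →
            ∀ Ψ : PeriodicTrialState (N + 1) (sideLength ρ (N + 1)),
              periodicEnergy (fun r => min (v r) (n : ℝ≥0∞)) Ψ ≤
                periodicGroundStateEnergy (fun r => min (v r) (n : ℝ≥0∞)) (N + 1) (sideLength ρ (N + 1)) + δ →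
              ENNReal.ofReal ((sideLength ρ (N + 1) ^ 3)⁻¹) *
                  (‖∫ X in cellN N (sideLength ρ (N + 1)), conj (Θ₀.ψ X) *
                      ∫ x in cell (sideLength ρ (N + 1)), Φ₀.ψ (Matrix.vecCons x X)‖₊ : ℝ≥0∞) ^ 2 ≤
                ENNReal.ofReal ((sideLength ρ (N + 1) ^ 3)⁻¹) *
                  (‖∫ X in cellN N (sideLength ρ (N + 1)), conj (Θ.ψ X) *
                      ∫ x in cell (sideLength ρ (N + 1)), Ψ.ψ (Matrix.vecCons x X)‖₊ : ℝ≥0∞) ^ 2 +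
                ENNReal.ofReal ε := by
  sorry

/-! ## S3 — the Bhattacharyya–Kantorovich identity for the residue (as an inequality) -/

/-- **S3 `stub_mixedLawResidue`.** For real positive `C¹` periodic states `Θ` (N bodies) and `Φ` (N+1 bodies) on the
torus of side `L > 0`, let `ψ = −log(|Φ|/|Θ∘tail|)` (insertion log-amplitude, `h = e^{−ψ}`), `ν = |Θ∘tail|² dZ` on
`cell^{N+1}` (mass `L³`) and `m = ν.tilted(−ψ) ∝ |Θ∘tail|·|Φ| dZ` the GEOMETRIC-MEAN (mixed-estimator) probability law.
Then EXACTLY `residue(Θ,Φ) = L⁻³ (ν[h])² = 1/(E_m[e^{ψ−E_mψ}] · E_m[e^{−(ψ−E_mψ)}])` (`E_m[1/h] = L³/ν[h]`,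
`E_m[h] = ν[h²]/ν[h] = 1/ν[h]`, and `∫ conj Θ ∫_cell Φ = ν[h]` by Fubini `cell^{N+1} = cell × cell^N` via
`Matrix.vecCons`); hence the two one-sided unit exponential-moment bounds give `e^{−(U+D)} ≤ residue`. Equivalent
forms (de Bruijn along the tilt path `π_s = ν.tilted(−2sψ)`): `log E_m e^{u} = H(m‖π₀) = 4∫₀^{1/2} s Var_{π_s}ψ ds`,
`log E_m e^{−u} = H(m‖π₁) = 4∫_{1/2}^1 (1−s) Var_{π_s}ψ ds` — the card's Chernoff integral, split at the midpoint.
Pure measure theory; positivity and continuity make every integral finite. Size: M. -/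
theorem stub_mixedLawResidue :
    ∀ (N : ℕ) (L : ℝ), 0 < L →
      ∀ (Θ : PeriodicTrialState N L) (Φ : PeriodicTrialState (N + 1) L),
        (∀ X, Θ.ψ X = (‖Θ.ψ X‖ : ℂ) ∧ 0 < ‖Θ.ψ X‖) →
        (∀ Z, Φ.ψ Z = (‖Φ.ψ Z‖ : ℂ) ∧ 0 < ‖Φ.ψ Z‖) →
        ∀ (ψ : Config (N + 1) → ℝ) (m : Measure (Config (N + 1))),
          (ψ = fun Z => -Real.log (‖Φ.ψ Z‖ / ‖Θ.ψ (Fin.tail Z)‖)) →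
          (m = (((volume : Measure (Config (N + 1))).restrict (cellN (N + 1) L)).withDensity
                  (fun Z => (‖Θ.ψ (Fin.tail Z)‖₊ : ℝ≥0∞) ^ 2)).tilted (fun Z => -ψ Z)) →
          ∀ (U D : ℝ),
            ∫ Z, Real.exp (ψ Z - ∫ Z', ψ Z' ∂m) ∂m ≤ Real.exp U →
            ∫ Z, Real.exp (-(ψ Z - ∫ Z', ψ Z' ∂m)) ∂m ≤ Real.exp D →
            ENNReal.ofReal (Real.exp (-(U + D))) ≤
              ENNReal.ofReal ((L ^ 3)⁻¹) *
                (‖∫ X in cellN N L, conj (Θ.ψ X) * ∫ x in cell L, Φ.ψ (Matrix.vecCons x X)‖₊ : ℝ≥0∞) ^ 2 := by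
  sorry

/-! ## S4 — the lever: the tilt family of weak corrector identities (C¹, bounded potential) -/

/-- **S4 `stub_tiltCorrector`** (the card's `HalfTiltCorrectorIdentity`, whole tilt family, `C¹` version as asked by
triage r1-2, `⊤`-valued potentials excluded by boundedness). For a BOUNDED admissible `w`, `L > 0`, and real positive
`C¹` periodic states `Θ`, `Φ` attaining the periodic `N`- and `(N+1)`-body ground-state energies (finite), the
insertion log-amplitude `ψ = −log(|Φ|/|Θ∘tail|)` is, for EVERY `s : ℝ`, a weak corrector
(`IsWeakCorrector`, tested on all `C¹` periodic functions of `Config (N+1)`) of the source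
`g_s = (W − μ_N) + (2s − 1)|∇ψ|²`, `W(Z) = ∑ⱼ w^{per}(z₀ − zⱼ)`, `μ_N = E₀(N+1) − E₀(N)`, for the weight
`F_s = |Θ∘tail|^{1−s} |Φ|^{s}` (generator `𝓛_s = 𝓛₀ − 2s∇ψ·∇`): at `s = ½` (geometric-mean weight) the equation is
LINEAR, `−𝓛_{1/2} ψ = W − μ_N`; `s = 0, 1` are the Riccati forms of `(−𝓛₀ + W)h = μ_N h`, `h = e^{−ψ}`, and of the
removal equation `(−𝓛₁ − W)h⁻¹ = −μ_N h⁻¹`. Why true: the weak Euler–Lagrange equations of `Θ` and `Φ` (minimality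
in the Bose-symmetric `C¹` class gives them against ALL `C¹` periodic test functions by symmetrising the test
function, cf. support item 12060) tested on `φ·|Θ∘tail|^{1−2s}|Φ|^{2s}` and `φ·|Θ∘tail|^{2−2s}|Φ|^{2s−1}`; the
gradient remainder is `(1−2s)|∇log|Θ∘tail| − ∇log|Φ||² F_s² = (1−2s)|∇ψ|²F_s²`. Testing `φ ≡ 1` yields the energy
budgets `(2s−1) E_{π_s}|∇ψ|² = μ_N − E_{π_s}W` (so `E_{π_1}|∇ψ|² ≤ μ_N`, `E_{π_{1/2}} W = μ_N`). Size: M–L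
(the weak E–L equation from minimality of the `ℝ≥0∞`-valued `periodicEnergy`). -/
theorem stub_tiltCorrector :
    ∀ (w : ℝ → ℝ≥0∞), IsRepulsiveFiniteRange w → (∃ M : ℝ≥0∞, M ≠ ⊤ ∧ ∀ r, w r ≤ M) →
      ∀ (N : ℕ) (L : ℝ), 0 < L →
        ∀ (Θ : PeriodicTrialState N L) (Φ : PeriodicTrialState (N + 1) L),
          (∀ X, Θ.ψ X = (‖Θ.ψ X‖ : ℂ) ∧ 0 < ‖Θ.ψ X‖) →
          (∀ Z, Φ.ψ Z = (‖Φ.ψ Z‖ : ℂ) ∧ 0 < ‖Φ.ψ Z‖) →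
          periodicEnergy w Θ = periodicGroundStateEnergy w N L →
          periodicEnergy w Φ = periodicGroundStateEnergy w (N + 1) L →
          periodicEnergy w Θ ≠ ⊤ → periodicEnergy w Φ ≠ ⊤ →
          ∀ (ψ : Config (N + 1) → ℝ),
            (ψ = fun Z => -Real.log (‖Φ.ψ Z‖ / ‖Θ.ψ (Fin.tail Z)‖)) →
            ∀ s : ℝ,
              IsWeakCorrector L
                (fun Z : Config (N + 1) => ‖Θ.ψ (Fin.tail Z)‖ ^ (1 - s) * ‖Φ.ψ Z‖ ^ s)
                (fun Z : Config (N + 1) =>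
                  (∑ j : Fin N, (periodizedPotential w L (Z 0 - Z j.succ)).toReal)
                    - ((periodicGroundStateEnergy w (N + 1) L).toReal
                        - (periodicGroundStateEnergy w N L).toReal)
                    + (2 * s - 1) * gradDot ψ ψ Z)
                ψ := by
  sorry

/-! ## S5 — the insertion half: `H(m ‖ π₀) ≤ C` uniformly (undressed side, recoil) -/

/-- **S5 `stub_insertionHalf`.** For the truncation family `v_n` of an admissible `v` whose K1-clause holds with
constants `(ρ_K, C_K)` for `n ≥ n₀` (output of S0), there are `ρ₀ > 0` and `C` such that for `ρ < ρ₀`, all large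
`N` (threshold uniform in `n`), every `n ≥ n₀` and every pair of real positive `C¹` ground states `(Θ, Φ)` of
`v_n` on the torus of side `L_N` satisfying the tilt-corrector identities of S4: the UPPER unit exponential moment
of the centred midpoint corrector is bounded, `E_m exp(ψ − E_mψ) ≤ e^{C}` — equivalently `H(m‖π₀) ≤ C`,
equivalently `4∫₀^{1/2} s·Var_{π_s}ψ ds ≤ C` (configurations where the insertion amplitude `h` is SMALL: impurity
squeezed against bath particles). Why plausibly true: at `s = 0` the law is the PRODUCT `|Θ|² ⊗ dy` and the
first corrector of `W̃` has the recoil-regularised `L²` bound `(ρ/4)∫|v̂|² m₋₁(k) k⁻² d³k < ∞` in `d = 3` from the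
K1-clause (per density mode: support `StaticResponseToHMinusOne` + Parseval in `y` + `(ω+k²)⁻² ≤ (4ωk²)⁻¹`);
Bogoliubov value of the whole half `≈ ½‖χ₁‖² ≈ 0.9√(ρa³)`; the weight `s` vanishes at the undressed end. Honest
difficulty: for `s ∈ (0, ½]` the generator `𝓛₀ − 2s∇ψ·∇` is not a product (no recoil lemma), and in the hard-core
limit `n → ∞` this half is UV-singular (`E_{π_s}|∇ψ|² → ∞` for `s ≤ ½`, Born series), so `n`-uniformity needs
`L²`/entropy (not `H₋₁`) control, e.g. via the pair-dressed splitting `h = (∏ⱼ f_n(y − xⱼ))·h'`. Size: XL. -/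
theorem stub_insertionHalf :
    ∀ (v : ℝ → ℝ≥0∞), IsRepulsiveFiniteRange v →
      ∀ (ρK CK : ℝ) (n₀ : ℕ), 0 < ρK →
        (∀ n : ℕ, n₀ ≤ n →
          ∀ ρ : ℝ, 0 < ρ → ρ < ρK → ∀ N : ℕ, ∀ k : Fin 3 → ℤ, k ≠ 0 → ∀ t : ℝ,
            ∀ Ψ : PeriodicTrialState N (sideLength ρ N),
              periodicEnergy (fun r => min (v r) (n : ℝ≥0∞)) Ψ ≠ ⊤ →
              (periodicGroundStateEnergy (fun r => min (v r) (n : ℝ≥0∞)) N (sideLength ρ N)).toReal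
                  - CK * t ^ 2 * N / max (ρ * (scatteringLength (fun r => min (v r) (n : ℝ≥0∞))).toReal)
                      ((2 * Real.pi / sideLength ρ N) ^ 2 * ∑ i, (k i : ℝ) ^ 2)
                ≤ (periodicEnergy (fun r => min (v r) (n : ℝ≥0∞)) Ψ).toReal
                  + t * ∫ X in cellN N (sideLength ρ N),
                      (∑ j, Real.cos (2 * Real.pi / sideLength ρ N * ∑ i, (k i : ℝ) * X j i)) * ‖Ψ.ψ X‖ ^ 2) →
        ∃ ρ₀ : ℝ, 0 < ρ₀ ∧ ∃ C : ℝ, ∀ ρ : ℝ, 0 < ρ → ρ < ρ₀ → ∀ᶠ N : ℕ in atTop, ∀ n : ℕ, n₀ ≤ n →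
          ∀ (Θ : PeriodicTrialState N (sideLength ρ (N + 1)))
            (Φ : PeriodicTrialState (N + 1) (sideLength ρ (N + 1))),
            (∀ X, Θ.ψ X = (‖Θ.ψ X‖ : ℂ) ∧ 0 < ‖Θ.ψ X‖) →
            (∀ Z, Φ.ψ Z = (‖Φ.ψ Z‖ : ℂ) ∧ 0 < ‖Φ.ψ Z‖) →
            periodicEnergy (fun r => min (v r) (n : ℝ≥0∞)) Θ =
              periodicGroundStateEnergy (fun r => min (v r) (n : ℝ≥0∞)) N (sideLength ρ (N + 1)) →
            periodicEnergy (fun r => min (v r) (n : ℝ≥0∞)) Φ =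
              periodicGroundStateEnergy (fun r => min (v r) (n : ℝ≥0∞)) (N + 1) (sideLength ρ (N + 1)) →
            periodicEnergy (fun r => min (v r) (n : ℝ≥0∞)) Θ ≠ ⊤ →
            periodicEnergy (fun r => min (v r) (n : ℝ≥0∞)) Φ ≠ ⊤ →
            ∀ (ψ : Config (N + 1) → ℝ),
              (ψ = fun Z => -Real.log (‖Φ.ψ Z‖ / ‖Θ.ψ (Fin.tail Z)‖)) →
              (∀ s : ℝ,
                IsWeakCorrector (sideLength ρ (N + 1))
                  (fun Z : Config (N + 1) => ‖Θ.ψ (Fin.tail Z)‖ ^ (1 - s) * ‖Φ.ψ Z‖ ^ s)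
                  (fun Z : Config (N + 1) =>
                    (∑ j : Fin N, (periodizedPotential (fun r => min (v r) (n : ℝ≥0∞))
                        (sideLength ρ (N + 1)) (Z 0 - Z j.succ)).toReal)
                      - ((periodicGroundStateEnergy (fun r => min (v r) (n : ℝ≥0∞)) (N + 1)
                            (sideLength ρ (N + 1))).toReal
                          - (periodicGroundStateEnergy (fun r => min (v r) (n : ℝ≥0∞)) N
                            (sideLength ρ (N + 1))).toReal)
                      + (2 * s - 1) * gradDot ψ ψ Z)
                  ψ) →
              ∀ (m : Measure (Config (N + 1))),
                (m = (((volume : Measure (Config (N + 1))).restrict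
                        (cellN (N + 1) (sideLength ρ (N + 1)))).withDensity
                        (fun Z => (‖Θ.ψ (Fin.tail Z)‖₊ : ℝ≥0∞) ^ 2)).tilted (fun Z => -ψ Z)) →
                ∫ Z, Real.exp (ψ Z - ∫ Z', ψ Z' ∂m) ∂m ≤ Real.exp C := by
  sorry

/-! ## S6 — the removal half: `H(m ‖ π₁) ≤ C` uniformly (dressed side; the infrared heart) -/

/-- **S6 `stub_removalHalf` (HARDEST).** Same frame as S5; conclusion: the LOWER unit exponential moment of the
centred midpoint corrector is bounded, `E_m exp(−(ψ − E_mψ)) ≤ e^{C}` — equivalently `H(m‖π₁) ≤ C`, equivalently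
`4∫_{1/2}^{1} (1−s)·Var_{π_s}ψ ds ≤ C` (configurations where `h` is LARGE: the impurity in a void of the full ground
state `π₁ = |Φ|²`). Why plausibly true: on `s ∈ (½, 1]` every input is an ENERGY — the relative Fisher information
of the tilts is `4s²E_{π_s}|∇ψ|² = 4s²(μ_N − E_{π_s}W)/(2s−1) ≤ 4s²μ_N/(2s−1)` (S4 tested on `1`, `W ≥ 0`), finite
even for hard cores (`∫(a/r²)² r²dr < ∞`), and `h⁻¹ = |Θ∘tail|/|Φ|` is the principal eigenfunction of the REMOVAL
operator `−𝓛₁ − W` over the `(N+1)`-body ground-state diffusion; its `L²`-flatness is an `ω⁻²` response of the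
`(N+1)`-bath to removing the coupling of one particle, controlled in Bogoliubov theory by the same compressibility
integral as the insertion (`½‖χ₁‖² ≈ 0.9√(ρa³)`), and the K1-clause is available at `N+1`. Honest difficulty (triage
r1-1/3): `π₁` has no product structure, so the recoil lemma is unavailable and Kipnis–Varadhan gives `H₋₁`, not
`L²`; the device to be found is a NON-perturbative `L²`/entropy comparison along the tilt path driven by the
corrector itself (`dπ_s/dπ_1 ∝ e^{2(1−s)ψ}`), not a series in the drift. This stub decides the line. Size: XL. -/
theorem stub_removalHalf :
    ∀ (v : ℝ → ℝ≥0∞), IsRepulsiveFiniteRange v →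
      ∀ (ρK CK : ℝ) (n₀ : ℕ), 0 < ρK →
        (∀ n : ℕ, n₀ ≤ n →
          ∀ ρ : ℝ, 0 < ρ → ρ < ρK → ∀ N : ℕ, ∀ k : Fin 3 → ℤ, k ≠ 0 → ∀ t : ℝ,
            ∀ Ψ : PeriodicTrialState N (sideLength ρ N),
              periodicEnergy (fun r => min (v r) (n : ℝ≥0∞)) Ψ ≠ ⊤ →
              (periodicGroundStateEnergy (fun r => min (v r) (n : ℝ≥0∞)) N (sideLength ρ N)).toReal
                  - CK * t ^ 2 * N / max (ρ * (scatteringLength (fun r => min (v r) (n : ℝ≥0∞))).toReal)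
                      ((2 * Real.pi / sideLength ρ N) ^ 2 * ∑ i, (k i : ℝ) ^ 2)
                ≤ (periodicEnergy (fun r => min (v r) (n : ℝ≥0∞)) Ψ).toReal
                  + t * ∫ X in cellN N (sideLength ρ N),
                      (∑ j, Real.cos (2 * Real.pi / sideLength ρ N * ∑ i, (k i : ℝ) * X j i)) * ‖Ψ.ψ X‖ ^ 2) →
        ∃ ρ₀ : ℝ, 0 < ρ₀ ∧ ∃ C : ℝ, ∀ ρ : ℝ, 0 < ρ → ρ < ρ₀ → ∀ᶠ N : ℕ in atTop, ∀ n : ℕ, n₀ ≤ n →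
          ∀ (Θ : PeriodicTrialState N (sideLength ρ (N + 1)))
            (Φ : PeriodicTrialState (N + 1) (sideLength ρ (N + 1))),
            (∀ X, Θ.ψ X = (‖Θ.ψ X‖ : ℂ) ∧ 0 < ‖Θ.ψ X‖) →
            (∀ Z, Φ.ψ Z = (‖Φ.ψ Z‖ : ℂ) ∧ 0 < ‖Φ.ψ Z‖) →
            periodicEnergy (fun r => min (v r) (n : ℝ≥0∞)) Θ =
              periodicGroundStateEnergy (fun r => min (v r) (n : ℝ≥0∞)) N (sideLength ρ (N + 1)) →
            periodicEnergy (fun r => min (v r) (n : ℝ≥0∞)) Φ =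
              periodicGroundStateEnergy (fun r => min (v r) (n : ℝ≥0∞)) (N + 1) (sideLength ρ (N + 1)) →
            periodicEnergy (fun r => min (v r) (n : ℝ≥0∞)) Θ ≠ ⊤ →
            periodicEnergy (fun r => min (v r) (n : ℝ≥0∞)) Φ ≠ ⊤ →
            ∀ (ψ : Config (N + 1) → ℝ),
              (ψ = fun Z => -Real.log (‖Φ.ψ Z‖ / ‖Θ.ψ (Fin.tail Z)‖)) →
              (∀ s : ℝ,
                IsWeakCorrector (sideLength ρ (N + 1))
                  (fun Z : Config (N + 1) => ‖Θ.ψ (Fin.tail Z)‖ ^ (1 - s) * ‖Φ.ψ Z‖ ^ s)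
                  (fun Z : Config (N + 1) =>
                    (∑ j : Fin N, (periodizedPotential (fun r => min (v r) (n : ℝ≥0∞))
                        (sideLength ρ (N + 1)) (Z 0 - Z j.succ)).toReal)
                      - ((periodicGroundStateEnergy (fun r => min (v r) (n : ℝ≥0∞)) (N + 1)
                            (sideLength ρ (N + 1))).toReal
                          - (periodicGroundStateEnergy (fun r => min (v r) (n : ℝ≥0∞)) N
                            (sideLength ρ (N + 1))).toReal)
                      + (2 * s - 1) * gradDot ψ ψ Z)
                  ψ) →
              ∀ (m : Measure (Config (N + 1))),
                (m = (((volume : Measure (Config (N + 1))).restrict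
                        (cellN (N + 1) (sideLength ρ (N + 1)))).withDensity
                        (fun Z => (‖Θ.ψ (Fin.tail Z)‖₊ : ℝ≥0∞) ^ 2)).tilted (fun Z => -ψ Z)) →
                ∫ Z, Real.exp (-(ψ Z - ∫ Z', ψ Z' ∂m)) ∂m ≤ Real.exp C := by
  sorry

/-! ## Small proved helpers for the composition -/

/-- `L_N = ((N+1)/ρ)^{1/3} > 0` for `ρ > 0`. [folklore] -/
theorem sideLength_succ_pos' {ρ : ℝ} (hρ : 0 < ρ) (N : ℕ) : 0 < sideLength ρ (N + 1) := by
  unfold sideLength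
  apply Real.rpow_pos_of_pos
  positivity

/-- The truncation `v_n = min(v, n)` of an admissible potential is admissible (same range). [folklore] -/
theorem isRepulsiveFiniteRange_trunc {v : ℝ → ℝ≥0∞} (hv : IsRepulsiveFiniteRange v) (n : ℕ) :
    IsRepulsiveFiniteRange (fun r => min (v r) (n : ℝ≥0∞)) := by
  refine ⟨hv.1.min measurable_const, ?_⟩
  obtain ⟨R₀, hR₀⟩ := hv.2
  refine ⟨R₀, fun r hr => ?_⟩
  show min (v r) (n : ℝ≥0∞) = 0
  rw [hR₀ r hr]
  exact min_eq_left (by simp)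

/-- The truncation is bounded by `n < ⊤`. [folklore] -/
theorem trunc_bounded (v : ℝ → ℝ≥0∞) (n : ℕ) :
    ∃ M : ℝ≥0∞, M ≠ ⊤ ∧ ∀ r, min (v r) (n : ℝ≥0∞) ≤ M :=
  ⟨n, ENNReal.natCast_ne_top n, fun r => min_le_right _ _⟩

/-- `ENNReal` bookkeeping of the last step: `e^{-K} ≤ R₀`, `R₀ ≤ R + e^{-K}/2` give `e^{-K}/2 ≤ R`. [folklore] -/
theorem half_le_of_exp_le {K : ℝ} {R₀ R : ℝ≥0∞}
    (hZ : ENNReal.ofReal (Real.exp (-K)) ≤ R₀)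
    (hS : R₀ ≤ R + ENNReal.ofReal (Real.exp (-K) / 2)) :
    ENNReal.ofReal (Real.exp (-K) / 2) ≤ R := by
  have hpos : 0 ≤ Real.exp (-K) / 2 := by positivity
  have hsplit : ENNReal.ofReal (Real.exp (-K)) =
      ENNReal.ofReal (Real.exp (-K) / 2) + ENNReal.ofReal (Real.exp (-K) / 2) := by
    rw [← ENNReal.ofReal_add hpos hpos]
    congr 1
    ring
  have h := hZ.trans hS
  rw [hsplit] at h
  exact (ENNReal.add_le_add_iff_right ENNReal.ofReal_ne_top).1 h

/-! ## The composition: the seven stubs give the crux BY NAME -/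

/-- **`CorrectorClosure` from the line `geometric-mean-corrector`** (kernel-checked, no `sorry` of its own).
Given K1: S0 makes the static response uniform over the truncation family; S2 (rigidity) and S5/S6 (the two halves,
fed with the K1-clause and with S4's corrector identities) hold eventually in `N` at every small density; S1 reduces
`InsertionResidue` for `v` to a residue bound for near-minimisers of `v_n`, `n ≥ n₀`; at such `(N, n)` the positive
ground states `(Θ₀, Φ₀)` of S2 have residue `≥ e^{−(C_U + C_D)}` by S3, and every pair of `δ`-near-minimisers
inherits `≥ e^{−(C_U+C_D)}/2` by S2's stability with `ε = e^{−(C_U+C_D)}/2`. -/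
theorem CorrectorClosure_of : CorrectorClosure := by
  intro hK1 v hv
  -- S0: truncation-stable static response (K1 by name)
  obtain ⟨ρK, hρK, CK, hCK, n₁, hresp⟩ := stub_truncationStableResponse hK1 v hv
  -- S2: fixed-N rigidity, eventually in N at low density
  obtain ⟨ρ₁, hρ₁, hrig⟩ := stub_groundStateRigidity v hv
  -- S5 / S6: the two halves, uniform over the truncation family
  obtain ⟨ρU, hρU, CU, hU⟩ := stub_insertionHalf v hv ρK CK n₁ hρK hresp
  obtain ⟨ρD, hρD, CD, hD⟩ := stub_removalHalf v hv ρK CK n₁ hρK hresp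
  -- S1: it suffices to bound the residue of near-minimisers of the truncations
  apply stub_truncationRemoval v hv
  refine ⟨min ρ₁ (min ρU ρD), lt_min hρ₁ (lt_min hρU hρD), fun ρ hρ hρlt => ?_⟩
  have hρ1 : ρ < ρ₁ := hρlt.trans_le (min_le_left _ _)
  have hρU' : ρ < ρU := hρlt.trans_le ((min_le_right _ _).trans (min_le_left _ _))
  have hρD' : ρ < ρD := hρlt.trans_le ((min_le_right _ _).trans (min_le_right _ _))
  set K : ℝ := CU + CD with hK
  refine ⟨Real.exp (-K) / 2, by positivity, ?_⟩
  filter_upwards [hrig ρ hρ hρ1, hU ρ hρ hρU', hD ρ hρ hρD'] with N hN1 hN2 hN3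
  obtain ⟨δ, hδ, n₂, hstab⟩ := hN1 (Real.exp (-K) / 2) (by positivity)
  refine ⟨δ, hδ, max n₁ n₂, fun n hn Θ hΘ Ψ hΨ => ?_⟩
  have hn₁ : n₁ ≤ n := le_of_max_le_left hn
  have hn₂ : n₂ ≤ n := le_of_max_le_right hn
  obtain ⟨Θ₀, Φ₀, hΘpos, hΦpos, hΘE, hΦE, hΘfin, hΦfin, hst⟩ := hstab n hn₂
  have hL : 0 < sideLength ρ (N + 1) := sideLength_succ_pos' hρ N
  -- S4: the tilt-corrector identities for the bounded truncation
  have hcorr := stub_tiltCorrector (fun r => min (v r) (n : ℝ≥0∞)) (isRepulsiveFiniteRange_trunc hv n)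
    (trunc_bounded v n) N (sideLength ρ (N + 1)) hL Θ₀ Φ₀ hΘpos hΦpos hΘE hΦE hΘfin hΦfin _ rfl
  -- S5 / S6 at (N, n, Θ₀, Φ₀)
  have hu := hN2 n hn₁ Θ₀ Φ₀ hΘpos hΦpos hΘE hΦE hΘfin hΦfin _ rfl hcorr _ rfl
  have hd := hN3 n hn₁ Θ₀ Φ₀ hΘpos hΦpos hΘE hΦE hΘfin hΦfin _ rfl hcorr _ rfl
  -- S3: the identity turns the two moment bounds into a residue bound for (Θ₀, Φ₀)
  have hZ := stub_mixedLawResidue N (sideLength ρ (N + 1)) hL Θ₀ Φ₀ hΘpos hΦpos _ _ rfl rfl CU CD hu hd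
  -- S2's stability transfers it to the near-minimisers (Θ, Ψ)
  exact half_le_of_exp_le hZ (hst Θ hΘ Ψ hΨ)

end Summit.AtomisticToContinuum.BoseEinsteinCondensation.Cruxes.CorrectorClosure.GeometricMeanCorrector

end
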